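import Summits.Ventures.PercRepro.Reduced
import Summits.Ventures.PercRepro.DeadEdges
import Summits.Ventures.PercRepro.C026AcyclicBridges
import Summits.Ventures.PercRepro.C026PendantA

/-!
# C-026 at every `p` on every marked multigraph that series–parallel-reduces to tree-or-hub-pair bridges
(p6, gen 10)

The pattern of p4's `SeriesParallelC005.lean`, for the three-mark inequality C-026: a **reduction step**
(`SPStep3`) replaces a series pair at a NON-MARK vertex of degree two (`IsSeries`, `Series.lean`: the
edges `y–x`, `x–z` become one edge `y–z` of weight `p₁ p₂`, the other dead) or a parallel pair
(`Parallel.lean`: one edge of weight `1 − (1 − p₁)(1 − p₂)`, the other dead).  The five partition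
probabilities of the marks are unchanged by a step (`IsSeries.prob_partitionEvent`,
`prob_partitionEvent_parallel`), so C-026 transports backwards along any chain of steps
(`C026At_of_step`, `C026At_of_reduces'`).  At the end of the chain the dead edges are deleted
(`prob_partitionEvent_eq_minor_of_dead`, `DeadEdges.lean`) and the live minor is handed to the
composition theorem: if its `{a, b, c}`-bridges are acyclic or hub-pair
(`c026_of_acyclicOrHubPair_bridges`, `C026AcyclicBridges.lean`), C-026 holds
(`C026At_of_liveMinor`, **`C026At_of_reduces`**).  (`V E : Type`, as in `DeadEdges.lean`.)

In words: C-026 holds at every edge weight on every marked multigraph whose series–parallel reduction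
at the non-marks, after deleting the dead edges, has tree-or-hub-pair `{a, b, c}`-bridges — every
subdivision (with parallel copies) of such a graph.
-/

namespace PercRepro

namespace MultiGraph

variable {V E : Type} [Fintype E] [DecidableEq E]

/-- **The C-026 inequality** for the marked multigraph `G` at the weight `p` and the marks `a, b, c`:
`(T + y₁)(y₁ + B) ≤ y₁ + y₂ + y₃`. -/
def C026At (G : MultiGraph V E) (p : E → ℝ) (a b c : V) : Prop :=
  (G.law3 p a b c 0 + G.law3 p a b c 1) * (G.law3 p a b c 1 + G.law3 p a b c 4) ≤
    G.law3 p a b c 1 + G.law3 p a b c 2 + G.law3 p a b c 3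

/-- **A series–parallel–pendant reduction step** of an instance `(G, p)` with marks `a, b, c`: a series
pair at a non-mark, a parallel pair, or an edge at a pendant non-mark (killed: weight `0`). -/
inductive SPStep3 (a b c : V) : MultiGraph V E × (E → ℝ) → MultiGraph V E × (E → ℝ) → Prop
  | series {G : MultiGraph V E} {p : E → ℝ} {e₁ e₂ : E} {x y z : V} (hs : G.IsSeries e₁ e₂ x y z)
      (hx : x ≠ a ∧ x ≠ b ∧ x ≠ c) :
      SPStep3 a b c (G, p) (G.seriesGraph e₁ y z, serWeight p e₁ e₂)
  | parallel {G : MultiGraph V E} {p : E → ℝ} {e₁ e₂ : E} (hne : e₁ ≠ e₂) (hpar : G.Parallel e₁ e₂) :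
      SPStep3 a b c (G, p) (G, parWeight p e₁ e₂)
  | pendant {G : MultiGraph V E} {p : E → ℝ} {v w : V} (hp : G.Pendant v w) (hvw : v ≠ w)
      (hv : v ≠ a ∧ v ≠ b ∧ v ≠ c) {f : E} (hf : f ∈ G.edgesAt ({v} : Set V)) :
      SPStep3 a b c (G, p) (G, Function.update p f 0)

/-- **Reduction**: the reflexive–transitive closure of the steps. -/
def Reduces3 (a b c : V) : MultiGraph V E × (E → ℝ) → MultiGraph V E × (E → ℝ) → Prop :=
  Relation.ReflTransGen (SPStep3 a b c)

omit [Fintype E] in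
/-- A step preserves probability vectors. -/
theorem SPStep3.isProb {a b c : V} {x y : MultiGraph V E × (E → ℝ)} (h : SPStep3 a b c x y)
    (hp : IsProb x.2) : IsProb y.2 := by
  cases h with
  | series hs hx => exact isProb_serWeight hp _ _
  | parallel hne hpar => exact isProb_parWeight hp _ _
  | @pendant G p v w _ _ _ f hf =>
    intro e
    show 0 ≤ Function.update p f 0 e ∧ Function.update p f 0 e ≤ 1
    by_cases he : e = f
    · subst he; simp
    · rw [Function.update_of_ne he]; exact hp e

omit [Fintype E] in
/-- A reduction preserves probability vectors. -/
theorem Reduces3.isProb {a b c : V} {x y : MultiGraph V E × (E → ℝ)} (h : Reduces3 a b c x y)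
    (hp : IsProb x.2) : IsProb y.2 := by
  induction h with
  | refl => exact hp
  | tail _ hstep ih => exact hstep.isProb ih

omit [Fintype E] [DecidableEq E] in
/-- The three marks avoid the non-mark of a series step. -/
theorem marks3_ne_of_ne {a b c x : V} (hx : x ≠ a ∧ x ≠ b ∧ x ≠ c) :
    ∀ i : Fin 3, (![a, b, c] : Fin 3 → V) i ≠ x := by
  intro i
  fin_cases i
  · exact hx.1.symm
  · exact hx.2.1.symm
  · exact hx.2.2.symm

/-- The partition law of the three marks is unchanged by a series step at a non-mark. -/
theorem IsSeries.law3 {G : MultiGraph V E} {e₁ e₂ : E} {x y z : V} (hs : G.IsSeries e₁ e₂ x y z)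
    (p : E → ℝ) {a b c : V} (hx : x ≠ a ∧ x ≠ b ∧ x ≠ c) :
    G.law3 p a b c = (G.seriesGraph e₁ y z).law3 (serWeight p e₁ e₂) a b c :=
  funext fun _ => hs.prob_partitionEvent p (marks3_ne_of_ne hx) _

/-- The partition law of the three marks is unchanged by a parallel step. -/
theorem law3_parallel {G : MultiGraph V E} {e₁ e₂ : E} (hne : e₁ ≠ e₂) (hpar : G.Parallel e₁ e₂)
    (p : E → ℝ) (a b c : V) : G.law3 p a b c = G.law3 (parWeight p e₁ e₂) a b c :=
  funext fun _ => G.prob_partitionEvent_parallel hne hpar p _ _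

omit [Fintype E] in
/-- Flipping an edge at a pendant vertex does not change the closed star at that vertex. -/
theorem closeStar_flipEdge {G : MultiGraph V E} (v : V) {f : E} (hf : f ∈ G.edgesAt ({v} : Set V))
    (ω : Config E) : G.closeStar v (PercRepro.flipEdge f ω) = G.closeStar v ω := by
  ext e
  by_cases he : e ∈ G.edgesAt ({v} : Set V)
  · rw [G.closeStar_apply_of_mem he, G.closeStar_apply_of_mem he]
  · have hef : e ≠ f := fun h => he (h ▸ hf)
    rw [G.closeStar_apply_of_notMem he, G.closeStar_apply_of_notMem he, PercRepro.flipEdge,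
      Function.update_of_ne hef]

omit [Fintype E] in
/-- Connectivity between vertices other than a pendant vertex `v` ignores the edges at `v`. -/
theorem conn_flipEdge_iff_of_pendant {G : MultiGraph V E} {v w : V} (hp : G.Pendant v w) (hvw : v ≠ w)
    {f : E} (hf : f ∈ G.edgesAt ({v} : Set V)) (ω : Config E) {x y : V} (hx : x ≠ v) (hy : y ≠ v) :
    G.Conn (PercRepro.flipEdge f ω) x y ↔ G.Conn ω x y := by
  rw [G.conn_closeStar_iff hp hvw hx hy, closeStar_flipEdge v hf,
    ← G.conn_closeStar_iff hp hvw hx hy]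

/-- **A pendant non-mark's edge may be killed**: the partition law of marks avoiding `v` is unchanged when
an edge at the pendant vertex `v` gets weight `0`. -/
theorem prob_partitionEvent_update_zero_of_pendant {G : MultiGraph V E} {v w : V} (hp : G.Pendant v w)
    (hvw : v ≠ w) {f : E} (hf : f ∈ G.edgesAt ({v} : Set V)) (p : E → ℝ) {k : ℕ} {m : Fin k → V}
    (hm : ∀ i, m i ≠ v) (rgs : Fin k → ℕ) :
    prob p (G.partitionEvent m rgs) = prob (Function.update p f 0) (G.partitionEvent m rgs) := by
  have hinv : PercRepro.flipEdge f ⁻¹' G.partitionEvent m rgs = G.partitionEvent m rgs := by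
    ext ω
    show PercRepro.flipEdge f ω ∈ G.partitionEvent m rgs ↔ ω ∈ G.partitionEvent m rgs
    simp only [partitionEvent, Set.mem_setOf_eq]
    exact forall_congr' fun i => forall_congr' fun j => by
      rw [G.conn_flipEdge_iff_of_pendant hp hvw hf ω (hm i) (hm j)]
  rw [prob_split p f, prob_update_zero_eq_prob_update_one_preimage p f, hinv]
  ring

/-- The three marks avoid a pendant non-mark. -/
theorem marks3_ne_of_ne' {a b c v : V} (hv : v ≠ a ∧ v ≠ b ∧ v ≠ c) :
    ∀ i : Fin 3, (![a, b, c] : Fin 3 → V) i ≠ v :=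
  marks3_ne_of_ne hv

/-- The partition law of the three marks is unchanged by killing an edge at a pendant non-mark. -/
theorem law3_pendant {G : MultiGraph V E} {v w : V} (hp : G.Pendant v w) (hvw : v ≠ w) {a b c : V}
    (hv : v ≠ a ∧ v ≠ b ∧ v ≠ c) {f : E} (hf : f ∈ G.edgesAt ({v} : Set V)) (p : E → ℝ) :
    G.law3 p a b c = G.law3 (Function.update p f 0) a b c :=
  funext fun _ => G.prob_partitionEvent_update_zero_of_pendant hp hvw hf p (marks3_ne_of_ne' hv) _

/-- **C-026 transports backwards along a step.** -/
theorem C026At_of_step {a b c : V} {x y : MultiGraph V E × (E → ℝ)} (h : SPStep3 a b c x y)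
    (hy : y.1.C026At y.2 a b c) : x.1.C026At x.2 a b c := by
  cases h with
  | @series G p e₁ e₂ x y z hs hx =>
    unfold C026At at hy ⊢
    rw [hs.law3 p hx]
    exact hy
  | @parallel G p e₁ e₂ hne hpar =>
    unfold C026At at hy ⊢
    rw [law3_parallel hne hpar p a b c]
    exact hy
  | @pendant G p v w hpv hvw hv f hf =>
    unfold C026At at hy ⊢
    rw [law3_pendant hpv hvw hv hf p]
    exact hy

/-- **C-026 transports backwards along a reduction.** -/
theorem C026At_of_reduces' {a b c : V} {x y : MultiGraph V E × (E → ℝ)} (h : Reduces3 a b c x y)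
    (hy : y.1.C026At y.2 a b c) : x.1.C026At x.2 a b c := by
  induction h using Relation.ReflTransGen.head_induction_on with
  | refl => exact hy
  | head hstep _ ih => exact C026At_of_step hstep ih

/-- The partition law of the three marks at `p` is the law of the live minor (dead edges deleted) at the
face weight. -/
theorem law3_eq_liveMinor (G : MultiGraph V E) (p : E → ℝ) (a b c : V) :
    G.law3 p a b c = (G.minor (liveConfig p) ⊥).law3 (faceWeight p (liveConfig p) ⊥)
      (G.sureClass ⊥ a) (G.sureClass ⊥ b) (G.sureClass ⊥ c) := by
  classical
  funext s
  have hd := deadOutside_liveConfig p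
  have hm : (fun i => G.sureClass ⊥ (![a, b, c] i)) =
      ![G.sureClass ⊥ a, G.sureClass ⊥ b, G.sureClass ⊥ c] := by
    funext i
    fin_cases i <;> rfl
  show prob p (G.partitionEvent ![a, b, c] (rgs3 s)) = _
  rw [G.prob_partitionEvent_eq_minor_of_dead p hd ![a, b, c] (rgs3 s), hm]
  rfl

/-- **The endpoint of a reduction**: C-026 at `p` when the live minor has tree-or-hub-pair bridges. -/
theorem C026At_of_liveMinor {ι : Type*} [Fintype ι] [DecidableEq ι] (G : MultiGraph V E)
    {p : E → ℝ} (hp : IsProb p) (a b c : V) (col : Face (liveConfig p) ⊥ → ι)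
    (hg : (G.minor (liveConfig p) ⊥).IsGluingN (G.sureClass ⊥ a) (G.sureClass ⊥ b) (G.sureClass ⊥ c)
      col)
    (h : ∀ i, ((G.minor (liveConfig p) ⊥).colPart col i).AcyclicOrHubPair (G.sureClass ⊥ a)
      (G.sureClass ⊥ b) (G.sureClass ⊥ c)) :
    G.C026At p a b c := by
  unfold C026At
  rw [G.law3_eq_liveMinor p a b c]
  exact c026_of_acyclicOrHubPair_bridges _ _ _ _ col hg h _ (isProb_faceWeight hp _ _)

/-- **C-026 for every instance that series–parallel-reduces to tree-or-hub-pair bridges**: if `(G, p)`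
reduces by series steps at non-marks and parallel steps to `(G', p')` whose live minor (the edges of
weight `0` deleted) has a colouring with every non-mark one-coloured and every colour class acyclic or
hub-pair, then C-026 holds for `G` at `p`. -/
theorem C026At_of_reduces {ι : Type*} [Fintype ι] [DecidableEq ι] {a b c : V}
    {G G' : MultiGraph V E} {p p' : E → ℝ} (hp : IsProb p) (h : Reduces3 a b c (G, p) (G', p'))
    (col : Face (liveConfig p') ⊥ → ι)
    (hg : (G'.minor (liveConfig p') ⊥).IsGluingN (G'.sureClass ⊥ a) (G'.sureClass ⊥ b)
      (G'.sureClass ⊥ c) col)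
    (hcol : ∀ i, ((G'.minor (liveConfig p') ⊥).colPart col i).AcyclicOrHubPair (G'.sureClass ⊥ a)
      (G'.sureClass ⊥ b) (G'.sureClass ⊥ c)) :
    G.C026At p a b c :=
  C026At_of_reduces' h (G'.C026At_of_liveMinor (h.isProb hp) a b c col hg hcol)

/-! ### The hub-pair endpoint without the quotient: hub-pair on the live edges of `G` itself -/

omit [Fintype E] [DecidableEq E] in
/-- With every edge sure-closed, the sure classes are the vertices. -/
theorem sureClass_bot_eq_iff (G : MultiGraph V E) (x y : V) :
    G.sureClass ⊥ x = G.sureClass ⊥ y ↔ x = y := by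
  rw [G.sureClass_eq_iff]
  constructor
  · intro h
    exact (G.eq_of_conn_of_forall_eq_false (fun _ => rfl) h).symm
  · rintro rfl
    exact Conn.refl G _ x

omit [Fintype E] [DecidableEq E] in
/-- **Hub-pair on the `u`-edges of `G`**: every non-mark has at most one non-mark neighbour through edges
open in `u`. -/
def IsHubPairOn (G : MultiGraph V E) (u : Config E) (a b c : V) : Prop :=
  ∀ v, v ≠ a → v ≠ b → v ≠ c → ∀ e e' w w', u e = true → u e' = true → G.Joins e v w →
    G.Joins e' v w' → w ≠ v → w' ≠ v → (w ≠ a ∧ w ≠ b ∧ w ≠ c) → (w' ≠ a ∧ w' ≠ b ∧ w' ≠ c) → w = w'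

omit [Fintype E] [DecidableEq E] in
/-- Fewer edges keep the property. -/
theorem IsHubPairOn.mono {G : MultiGraph V E} {u u' : Config E} (h : u' ≤ u) {a b c : V}
    (hu : G.IsHubPairOn u a b c) : G.IsHubPairOn u' a b c :=
  fun v hva hvb hvc e e' w w' he he' => hu v hva hvb hvc e e' w w'
    (Bool.le_iff_imp.1 (h e) he) (Bool.le_iff_imp.1 (h e') he')

omit [Fintype E] [DecidableEq E] in
/-- **The minor on the `u`-edges is a hub-pair multigraph** when `G` is hub-pair on the `u`-edges. -/
theorem IsHubPairOn.minor_bot {G : MultiGraph V E} {u : Config E} {a b c : V}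
    (hu : G.IsHubPairOn u a b c) :
    (G.minor u ⊥).IsHubPairGraph (G.sureClass ⊥ a) (G.sureClass ⊥ b) (G.sureClass ⊥ c) := by
  intro v' hva hvb hvc e e' w' w'' he he' hw' hw'' hwm hwm'
  induction v' using Quotient.inductionOn' with
  | h v =>
  induction w' using Quotient.inductionOn' with
  | h w =>
  induction w'' using Quotient.inductionOn' with
  | h w₂ =>
  have key : ∀ (f : Face u ⊥) (x y : V), (G.minor u ⊥).Joins f (G.sureClass ⊥ x) (G.sureClass ⊥ y) →
      G.Joins f.1 x y := by
    intro f x y hf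
    rcases hf with ⟨h1, h2⟩ | ⟨h1, h2⟩
    · exact Or.inl ⟨(G.sureClass_bot_eq_iff _ _).1 h1, (G.sureClass_bot_eq_iff _ _).1 h2⟩
    · exact Or.inr ⟨(G.sureClass_bot_eq_iff _ _).1 h1, (G.sureClass_bot_eq_iff _ _).1 h2⟩
  have hne : ∀ x y : V, G.sureClass ⊥ x ≠ G.sureClass ⊥ y → x ≠ y :=
    fun x y h hxy => h ((G.sureClass_bot_eq_iff x y).2 hxy)
  have := hu v (hne _ _ hva) (hne _ _ hvb) (hne _ _ hvc) e.1 e'.1 w w₂ e.2.2 e'.2.2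
    (key e v w he) (key e' v w₂ he') (hne _ _ hw') (hne _ _ hw'')
    ⟨hne _ _ hwm.1, hne _ _ hwm.2.1, hne _ _ hwm.2.2⟩ ⟨hne _ _ hwm'.1, hne _ _ hwm'.2.1, hne _ _ hwm'.2.2⟩
  exact (G.sureClass_bot_eq_iff _ _).2 this

omit [Fintype E] [DecidableEq E] in
/-- A sufficient condition for `IsHubPairOn`: every `u`-open edge between two non-marks joins the same
pair `{x, y}`. -/
theorem isHubPairOn_of_pair (G : MultiGraph V E) (u : Config E) (a b c x y : V)
    (h : ∀ e, u e = true → (G.fst e ≠ a ∧ G.fst e ≠ b ∧ G.fst e ≠ c) →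
      (G.snd e ≠ a ∧ G.snd e ≠ b ∧ G.snd e ≠ c) →
      (G.fst e = x ∧ G.snd e = y) ∨ (G.fst e = y ∧ G.snd e = x)) :
    G.IsHubPairOn u a b c := by
  intro v hva hvb hvc e e' w w' he he' hj hj' hwv hw'v hw hw'
  have key : ∀ (f : E) (w : V), u f = true → G.Joins f v w → (w ≠ a ∧ w ≠ b ∧ w ≠ c) →
      (v = x ∧ w = y) ∨ (v = y ∧ w = x) := by
    intro f w hf hjf hw
    rcases hjf with ⟨h1, h2⟩ | ⟨h1, h2⟩
    · rcases h f hf (by rw [h1]; exact ⟨hva, hvb, hvc⟩) (by rw [h2]; exact hw) with ⟨h3, h4⟩ | ⟨h3, h4⟩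
      · exact Or.inl ⟨h1.symm.trans h3, h2.symm.trans h4⟩
      · exact Or.inr ⟨h1.symm.trans h3, h2.symm.trans h4⟩
    · rcases h f hf (by rw [h1]; exact hw) (by rw [h2]; exact ⟨hva, hvb, hvc⟩) with ⟨h3, h4⟩ | ⟨h3, h4⟩
      · exact Or.inr ⟨h2.symm.trans h4, h1.symm.trans h3⟩
      · exact Or.inl ⟨h2.symm.trans h4, h1.symm.trans h3⟩
  rcases key e w he hj hw with ⟨h1, h2⟩ | ⟨h1, h2⟩ <;>
    rcases key e' w' he' hj' hw' with ⟨h3, h4⟩ | ⟨h3, h4⟩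
  · exact h2.trans h4.symm
  · exact absurd (h2.trans h3.symm) hwv
  · exact absurd (h2.trans h3.symm) hwv
  · exact h2.trans h4.symm

/-- **The hub-pair endpoint**: C-026 at `p` when `G` is hub-pair on its live edges (p5's `c026_hubPair`
on the live minor). -/
theorem C026At_of_isHubPairOn_live (G : MultiGraph V E) {p : E → ℝ} (hp : IsProb p) (a b c : V)
    (h : G.IsHubPairOn (liveConfig p) a b c) : G.C026At p a b c := by
  unfold C026At
  rw [G.law3_eq_liveMinor p a b c]
  exact c026_hubPair _ h.minor_bot _ (isProb_faceWeight hp _ _)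

/-- **C-026 for every instance that series–parallel-reduces to a hub-pair live graph.** -/
theorem C026At_of_reduces_hubPair {a b c : V} {G G' : MultiGraph V E} {p p' : E → ℝ} (hp : IsProb p)
    (h : Reduces3 a b c (G, p) (G', p')) (hG' : G'.IsHubPairOn (liveConfig p') a b c) :
    G.C026At p a b c :=
  C026At_of_reduces' h (G'.C026At_of_isHubPairOn_live (h.isProb hp) a b c hG')

end MultiGraph

end PercRepro
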